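import Summits.QuantumFields.YangMills.Theorems.PoincareLipschitzMassRowsOfLowCharts
import Summits.QuantumFields.YangMills.Theorems.PoincareLipschitzChartsOfOrbitMinRegularityLetters
import Summits.QuantumFields.YangMills.Theorems.PoincareLipschitzLevelOneLipschitz
import Summits.QuantumFields.YangMills.Theses.PoincareLipschitz
import HarnessLib

/-!
# Crux stmt-QuantumFields-19936 `UnitScaleTilt.HistoryTailL`, route crux `PoincareLipschitz.BlockLipschitzL` (stmt-QuantumFields-23533) BY NAME,
# MODULO THE HÖLDER SOCKET «LOC-REG-MIN-H» (`hRegH`): `‖pertVar‖ ≤ Λ·(R^{−1∕2} + θ^{1∕2}·R^{1∕2})` at box-`ℓ²`-orbit minimisers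

Cell `ym3-torus` (YM ladder rung R3 = continuum SU(2) Yang–Mills on T³ — a RUNG, NOT the Clay problem); width seat `ym-ust-19936-w2` g11, F6 pen (LEAD
`ym-ust-19936-w1` g8 RULING 05:29:02Z «K2 END-GAME ARCHITECTURE: one socket for the organ, HÖLDER suffices at the consumer»).  Helper `--supports
stmt-QuantumFields-19936`; THEOREMS ONLY (0 `def`, 0 `sorry`).  CONDITIONAL on the displayed `hRegH` (NOT proved anywhere); does NOT close 23533.

THE POINT.  ✓`PoincareLipschitzChartsOfOrbitMinRegularity.charts_of_orbitMinRegularity` consumed the ε-regularity socket `hReg` (`Λ(R⁻¹ + θR²)`, the Lipschitz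
law) only through a geometric decay in the depth and a positive power of `θ`; the regularity lane of the organ (px7 small-range ∕ ★w5–px8 E→R) delivers a
HÖLDER law `‖pertVar(b)‖ ≲ √φ∕√R + √(θ_iR)`.  THIS FILE is the same knit for the Hölder socket `hRegH` = `hReg` with the last clause replaced by
`‖pertVar (ŪⁱU) ((ŪⁱU′)^h) b‖ ≤ Λ·((√R)⁻¹ + √(θBal(K−i))·√R)` (frozen text: HOME `FROZEN-F6-LOCREGMINH-hypothesis.w2g11.lean.txt`): rooms
`R_i := min(L^{⌊(j−i)∕2⌋}, max(1, θ_i^{−1∕2}))`, so `B_i ≤ Λ((√L)^{−k_i} + 2θ_i^{1∕4} + θ_i^{1∕2})`; two geometric means give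
`min(A_i, Λ(√L)^{−k_i}) ≤ √(√(2θ_jΛ)·Λ·√L)·(L^{1∕8})^{−k_i}` (`A_i·X_i ≤ 2θ_jΛ(√L)^{k_i+2}`), and `Σ_i (L^{1∕8})^{−k_i} ≤ (1 − L^{−1∕16})⁻¹` (letters
✓`sum_inv_pow_half_le` at `s := L^{1∕8}`) — the SAME series constant `G` as before; `Σ_{i<j}σ_i ≤ K_tot·γ^{1∕16}`, every root a `Real.sqrt`.

WHAT IS PROVED (ns `…Theorems.PoincareLipschitzChartsOfOrbitMinHolderRegularity`; letters in ✓`…ChartsOfOrbitMinRegularityLetters`).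
* §3 ★★★ `charts_of_orbitMinHolderRegularity (hRegH) : hCharts` (✓p690785's hypothesis VERBATIM, `T := 1`); §4 ★★★ `avgStability_star_of_orbitMinHolderRegularity`,
  ★★★ `stub_iteratedLipschitz_of_orbitMinHolderRegularity` (line #12's stub VERBATIM), ★★★ `blockLipschitzL_of_orbitMinHolderRegularity (hRegH) :
  Summit.QuantumFields.YangMills.Theses.PoincareLipschitz.BlockLipschitzL`.
HONEST SCOPE.  Bookkeeping; `hRegH` (LEAD's knit of record: `hRegH ⟸ hImprove ∧ [A] ∧ [C] ∧ [D]`, with `hImprove` = «energy improvement at bounded normalised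
energy», Schoen–Uhlenbeck by compactness in print) is NOT proved; nothing of 23533 ∕ 19936 is closed.  YM₃ on T³ is rung R3, not Clay; YM gap NOT proved.

References: T. Bałaban, CMP 98 (1985) 17–51 [Balaban1985Averaging] (Props 1–3 p.36); CMP 109 (1987) 249–301 [Balaban1987RG1] ((0.4) p.253); CMP 102 (1985)
255–275 [Balaban1985UV3] ((7) p.257); R. Schoen, K. Uhlenbeck, J. Diff. Geom. 17 (1982) 307–335 [SchoenUhlenbeck1982]; Y. L. Xin, Duke Math. J. 47 (1980) 609–613 [Xin1980].
-/

noncomputable section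

open scoped BigOperators Matrix.Norms.L2Operator
open NormedSpace

namespace Summit.QuantumFields.YangMills.Theorems.PoincareLipschitzChartsOfOrbitMinHolderRegularity

open Literature.MathematicalPhysics.QuantumFieldTheory.Balaban1983to89
open Literature.MathematicalPhysics.QuantumFieldTheory.Balaban1983to89.T3ContinuumYM3Torus
open Literature.MathematicalPhysics.QuantumFieldTheory.Balaban1983to89.T3UnitScaleTilt (θBal)
open Finset T4Continuum BlockAveraging AveragingRT ExpMeanLog BlockAveragingEMLLinearised BlockAveragingEMLLinearisedBackground
open Summit.QuantumFields.YangMills.Theorems.PoincareLipschitzChartsOfOrbitMinRegularityLetters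
open Literature.NumberTheory.Automorphic (real_sqrt_pow)
open T3MinimiserStabilityReduction (θBal_pos)
open Summit.QuantumFields.YangMills.Theorems.PoincareLipschitzMassRowsOfCharts (avgStability_star_of_charts stub_iteratedLipschitz_of_charts)
open Summit.QuantumFields.YangMills.Theorems.PoincareLipschitzMassRowsOfLowCharts (norm_le_sqrt_of_mem)
open Summit.QuantumFields.YangMills.Theorems.PoincareLipschitzLevelOneLipschitz (stub_levelOneLipschitz)

/-! ## §3 The per-bond charts from the Hölder regularity of the orbit minimisers -/

set_option maxHeartbeats 800000 in
/-- ★★★ **CHARTS ⟸ LOC-REG-MIN-H (the Hölder socket).**  ✓`PoincareLipschitzMassRowsOfCharts`'s `hCharts` (VERBATIM, `T := 1`) from `hRegH`: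
rooms `R_i = min(L^{⌊(j−i)∕2⌋}, max(1, θ_i^{−1∕2}))`, charts `σ_i = min(2θ_j√(L^{j+1−i}), Λ((√R_i)⁻¹ + √θ_i·√R_i))`, `Σ_{i<j}σ_i ≤ K_tot·γ^{1∕16} ≤ (10⁷L⁷)⁻¹`.
[cite: Balaban1985Averaging, Props 1-3 (122)-(126) p.36; Balaban1985UV3, (7) p.257; SchoenUhlenbeck1982, Thm IV] -/
theorem charts_of_orbitMinHolderRegularity
    (hRegH : open Literature.MathematicalPhysics.QuantumFieldTheory.Balaban1983to89 Literature.MathematicalPhysics.QuantumFieldTheory.Balaban1983to89.T3ContinuumYM3Torus in ∀ (L : ℕ), ∃ Λ : ℝ, 0 < Λ ∧ ∀ (b₀ p₀ : ℝ), 0 < b₀ → 2 < p₀ → ∃ γ₃ : ℝ, 0 < γ₃ ∧ ∀ (F : T3Family) (γ : ℝ), F.L = L → 0 < γ → γ ≤ γ₃ → ∀ (K j : ℕ), 1 ≤ j → j + 3 ≤ K → ∀ (a : Plaq (F.P K) (j + 1)) (U U' : GaugeField (F.P K) 0 (Matrix.specialUnitaryGroup (Fin 2) ℂ)), (∀ (i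 : ℕ) (q : Plaq (F.P K) i), i < j + 1 → Site.tdist (fun k => ((((q.src k).val * F.L ^ i : ℕ)) : ZMod ((F.P K).sitesPerDir 0))) (fun k => ((((a.src k).val * F.L ^ (j + 1) : ℕ)) : ZMod ((F.P K).sitesPerDir 0))) + 64 * F.L ^ i ≤ 64 * F.L ^ (j + 1) → GaugeGroup.dist1 (GaugeField.plaqHol (Averaging.iter (fun i' => BlockAveraging.blockAvg (P := F.P K) (j := i') T3UnitLawDensityEML.ℰp) i U) q) < T3UnitScaleTilt.θBal F.L γ b₀ p₀ (K - i)) → (∀ (i : ℕ) (q : Plaq (F.P K) i), i < j + 1 → Site.tdist (fun k => ((((q.src k).val * F.L ^ i : ℕ)) : ZMod ((F.P K).sitesPerDir 0))) (fun k => ((((a.src k).val * F.L ^ (j + 1) : ℕ)) : ZMod ((F.P K).sitesPerDir 0))) + 64 * F.L ^ i ≤ 64 * F.L ^ (j + 1) → GaugeGroup.dist1 (GaugeField.plaqHol (Averaging.iter (fun i' => BlockAveraging.blockAvg (P := F.P K) (j := i') T3UnitLawDensityEML.ℰp) i U') q) < T3UnitScaleTilt.θBal F.L γ b₀ p₀ (K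 - i)) → ∀ (i : ℕ), i < j → ∀ (M : ℕ) (h : GaugeTransf (F.P K) i (Matrix.specialUnitaryGroup (Fin 2) ℂ)), (∀ k' : GaugeTransf (F.P K) i (Matrix.specialUnitaryGroup (Fin 2) ℂ), (∑ b : PBond (F.P K) i, if b ∈ Finset.univ.filter (fun b : PBond (F.P K) i => Site.tdist (fun k => ((((b.src k).val * F.L ^ i : ℕ)) : ZMod ((F.P K).sitesPerDir 0))) (fun k => ((((a.src k).val * F.L ^ (j + 1) : ℕ)) : ZMod ((F.P K).sitesPerDir 0))) + 2 * F.L ^ (i + 1) + M ≤ 8 * F.L ^ (j + 1)) then GaugeGroup.dist1 (Averaging.iter (fun i' => BlockAveraging.blockAvg (P := F.P K) (j := i') T3UnitLawDensityEML.ℰp) i U b * (GaugeField.gaugeAct h (Averaging.iter (fun i' => BlockAveraging.blockAvg (P := F.P K) (j := i') T3UnitLawDensityEML.ℰp) i U') b)⁻¹) ^ 2 else 0) ≤ ∑ b : PBond (F.P K) i, if b ∈ Finset.univ.filter (fun b : PBond (F.P K) i => Site.tdist (fun k => ((((b.src k).val * F.L ^ i : ℕ)) : ZMod ((F.P K).sitesPerDir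 0))) (fun k => ((((a.src k).val * F.L ^ (j + 1) : ℕ)) : ZMod ((F.P K).sitesPerDir 0))) + 2 * F.L ^ (i + 1) + M ≤ 8 * F.L ^ (j + 1)) then GaugeGroup.dist1 (Averaging.iter (fun i' => BlockAveraging.blockAvg (P := F.P K) (j := i') T3UnitLawDensityEML.ℰp) i U b * (GaugeField.gaugeAct k' (GaugeField.gaugeAct h (Averaging.iter (fun i' => BlockAveraging.blockAvg (P := F.P K) (j := i') T3UnitLawDensityEML.ℰp) i U')) b)⁻¹) ^ 2 else 0) → ∀ (b : PBond (F.P K) i) (R : ℝ), 1 ≤ R → ((Site.tdist (fun k => ((((b.src k).val * F.L ^ i : ℕ)) : ZMod ((F.P K).sitesPerDir 0))) (fun k => ((((a.src k).val * F.L ^ (j + 1) : ℕ)) : ZMod ((F.P K).sitesPerDir 0))) : ℕ) : ℝ) + R * (F.L : ℝ) ^ i + 2 * (F.L : ℝ) ^ (i + 1) + (M : ℝ) ≤ 8 * (F.L : ℝ) ^ (j + 1) → ‖BlockAveragingEMLLinearisedBackground.pertVar (Averaging.iter (fun i' => BlockAveraging.blockAvg (P := F.P K) (j := i') T3UnitLawDensityEML.ℰp)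 i U) (GaugeField.gaugeAct h (Averaging.iter (fun i' => BlockAveraging.blockAvg (P := F.P K) (j := i') T3UnitLawDensityEML.ℰp) i U')) b‖ ≤ Λ * ((Real.sqrt R)⁻¹ + Real.sqrt (T3UnitScaleTilt.θBal F.L γ b₀ p₀ (K - i)) * Real.sqrt R)) :
    open Literature.MathematicalPhysics.QuantumFieldTheory.Balaban1983to89 Literature.MathematicalPhysics.QuantumFieldTheory.Balaban1983to89.T3ContinuumYM3Torus in ∀ (L : ℕ), ∃ T : ℝ, 0 < T ∧ ∀ (b₀ p₀ : ℝ), 0 < b₀ → 2 < p₀ → ∃ γ₂ : ℝ, 0 < γ₂ ∧ ∀ (F : T3Family) (γ : ℝ), F.L = L → 0 < γ → γ ≤ γ₂ → ∀ (K j : ℕ), 1 ≤ j → j + 3 ≤ K → ∀ (a : Plaq (F.P K) (j + 1)) (U U' : GaugeField (F.P K) 0 (Matrix.specialUnitaryGroup (Fin 2) ℂ)), (∀ (i : ℕ) (q : Plaq (F.P K) i), i < j + 1 → Site.tdist (fun k => ((((q.src k).val * F.L ^ i : ℕ)) : ZMod ((F.P K).sitesPerDir 0))) (fun k => ((((a.src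 k).val * F.L ^ (j + 1) : ℕ)) : ZMod ((F.P K).sitesPerDir 0))) + 64 * F.L ^ i ≤ 64 * F.L ^ (j + 1) → GaugeGroup.dist1 (GaugeField.plaqHol (Averaging.iter (fun i' => BlockAveraging.blockAvg (P := F.P K) (j := i') T3UnitLawDensityEML.ℰp) i U) q) < T3UnitScaleTilt.θBal F.L γ b₀ p₀ (K - i)) → (∀ (i : ℕ) (q : Plaq (F.P K) i), i < j + 1 → Site.tdist (fun k => ((((q.src k).val * F.L ^ i : ℕ)) : ZMod ((F.P K).sitesPerDir 0))) (fun k => ((((a.src k).val * F.L ^ (j + 1) : ℕ)) : ZMod ((F.P K).sitesPerDir 0))) + 64 * F.L ^ i ≤ 64 * F.L ^ (j + 1) → GaugeGroup.dist1 (GaugeField.plaqHol (Averaging.iter (fun i' => BlockAveraging.blockAvg (P := F.P K) (j := i') T3UnitLawDensityEML.ℰp) i U') q) < T3UnitScaleTilt.θBal F.L γ b₀ p₀ (K - i)) → (∀ k : GaugeTransf (F.P K) 0 (Matrix.specialUnitaryGroup (Fin 2) ℂ), (∑ b : PBond (F.P K) 0, if (∀ k, (b.src k - ((((a.src k).val *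 F.L ^ (j + 1) : ℕ)) : ZMod ((F.P K).sitesPerDir 0)) + ((8 * F.L ^ (j + 1) : ℕ) : ZMod ((F.P K).sitesPerDir 0))).val < 17 * F.L ^ (j + 1)) ∧ (∀ k, (b.tgt k - ((((a.src k).val * F.L ^ (j + 1) : ℕ)) : ZMod ((F.P K).sitesPerDir 0)) + ((8 * F.L ^ (j + 1) : ℕ) : ZMod ((F.P K).sitesPerDir 0))).val < 17 * F.L ^ (j + 1)) then GaugeGroup.dist1 (U b * (U' b)⁻¹) ^ 2 else 0) ≤ (∑ b : PBond (F.P K) 0, if (∀ k, (b.src k - ((((a.src k).val * F.L ^ (j + 1) : ℕ)) : ZMod ((F.P K).sitesPerDir 0)) + ((8 * F.L ^ (j + 1) : ℕ) : ZMod ((F.P K).sitesPerDir 0))).val < 17 * F.L ^ (j + 1)) ∧ (∀ k, (b.tgt k - ((((a.src k).val * F.L ^ (j + 1) : ℕ)) : ZMod ((F.P K).sitesPerDir 0)) + ((8 * F.L ^ (j + 1) : ℕ) : ZMod ((F.P K).sitesPerDir 0))).val < 17 * F.L ^ (j + 1)) then GaugeGroup.dist1 (U b * (GaugeField.gaugeAct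 k U' b)⁻¹) ^ 2 else 0)) → Real.sqrt (∑ b : PBond (F.P K) 0, if (∀ k, (b.src k - ((((a.src k).val * F.L ^ (j + 1) : ℕ)) : ZMod ((F.P K).sitesPerDir 0)) + ((8 * F.L ^ (j + 1) : ℕ) : ZMod ((F.P K).sitesPerDir 0))).val < 17 * F.L ^ (j + 1)) ∧ (∀ k, (b.tgt k - ((((a.src k).val * F.L ^ (j + 1) : ℕ)) : ZMod ((F.P K).sitesPerDir 0)) + ((8 * F.L ^ (j + 1) : ℕ) : ZMod ((F.P K).sitesPerDir 0))).val < 17 * F.L ^ (j + 1)) then GaugeGroup.dist1 (U b * (U' b)⁻¹) ^ 2 else 0) ≤ T * Real.sqrt ((F.L : ℝ) ^ (j + 1)) * T3UnitScaleTilt.θBal F.L γ b₀ p₀ (K - j) → ∃ m : ℕ → ℕ, (∀ i, m i ≤ m (i + 1)) ∧ m j ≤ F.L ^ (j + 1) ∧ ∃ σ : ℕ → ℝ, (∀ i, i < j → 0 ≤ σ i ∧ σ i ≤ 1 / (10 ^ 7 * (L : ℝ) ^ 4)) ∧ (∑ i ∈ Finset.range j, σ i ≤ 1 / (10 ^ 7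 * (L : ℝ) ^ 7)) ∧ ∀ i, i < j → ∀ h : GaugeTransf (F.P K) i (Matrix.specialUnitaryGroup (Fin 2) ℂ), (∀ k' : GaugeTransf (F.P K) i (Matrix.specialUnitaryGroup (Fin 2) ℂ), (∑ b : PBond (F.P K) i, if b ∈ Finset.univ.filter (fun b : PBond (F.P K) i => Site.tdist (fun k => ((((b.src k).val * F.L ^ i : ℕ)) : ZMod ((F.P K).sitesPerDir 0))) (fun k => ((((a.src k).val * F.L ^ (j + 1) : ℕ)) : ZMod ((F.P K).sitesPerDir 0))) + 2 * F.L ^ (i + 1) + m i ≤ 8 * F.L ^ (j + 1)) then GaugeGroup.dist1 (Averaging.iter (fun i' => BlockAveraging.blockAvg (P := F.P K) (j := i') T3UnitLawDensityEML.ℰp) i U b * (GaugeField.gaugeAct h (Averaging.iter (fun i' => BlockAveraging.blockAvg (P := F.P K) (j := i') T3UnitLawDensityEML.ℰp) i U') b)⁻¹) ^ 2 else 0) ≤ ∑ b : PBond (F.P K) i, if b ∈ Finset.univ.filter (fun b : PBond (F.P K) i => Site.tdist (fun k => ((((b.src k).val * F.L ^ i : ℕ)) : ZMod ((F.P K).sitesPerDir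 0))) (fun k => ((((a.src k).val * F.L ^ (j + 1) : ℕ)) : ZMod ((F.P K).sitesPerDir 0))) + 2 * F.L ^ (i + 1) + m i ≤ 8 * F.L ^ (j + 1)) then GaugeGroup.dist1 (Averaging.iter (fun i' => BlockAveraging.blockAvg (P := F.P K) (j := i') T3UnitLawDensityEML.ℰp) i U b * (GaugeField.gaugeAct k' (GaugeField.gaugeAct h (Averaging.iter (fun i' => BlockAveraging.blockAvg (P := F.P K) (j := i') T3UnitLawDensityEML.ℰp) i U')) b)⁻¹) ^ 2 else 0) → ∑ b ∈ Finset.univ.filter (fun b : PBond (F.P K) i => Site.tdist (fun k => ((((b.src k).val * F.L ^ i : ℕ)) : ZMod ((F.P K).sitesPerDir 0))) (fun k => ((((a.src k).val * F.L ^ (j + 1) : ℕ)) : ZMod ((F.P K).sitesPerDir 0))) + 2 * F.L ^ (i + 1) + m i ≤ 8 * F.L ^ (j + 1)), ‖BlockAveragingEMLLinearisedBackground.pertVar (Averaging.iter (fun i' => BlockAveraging.blockAvg (P := F.P K) (j := i') T3UnitLawDensityEML.ℰp) i U) (GaugeField.gaugeAct h (Averaging.iter (fun i' => BlockAveraging.blockAvg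 (P := F.P K) (j := i') T3UnitLawDensityEML.ℰp) i U')) b‖ ^ 2 ≤ 4 * ((F.L : ℝ) ^ i)⁻¹ * (∑ b : PBond (F.P K) 0, if (∀ k, (b.src k - ((((a.src k).val * F.L ^ (j + 1) : ℕ)) : ZMod ((F.P K).sitesPerDir 0)) + ((8 * F.L ^ (j + 1) : ℕ) : ZMod ((F.P K).sitesPerDir 0))).val < 17 * F.L ^ (j + 1)) ∧ (∀ k, (b.tgt k - ((((a.src k).val * F.L ^ (j + 1) : ℕ)) : ZMod ((F.P K).sitesPerDir 0)) + ((8 * F.L ^ (j + 1) : ℕ) : ZMod ((F.P K).sitesPerDir 0))).val < 17 * F.L ^ (j + 1)) then GaugeGroup.dist1 (U b * (U' b)⁻¹) ^ 2 else 0) → ∀ c ∈ Finset.univ.filter (fun b : PBond (F.P K) (i + 1) => Site.tdist (fun k => ((((b.src k).val * F.L ^ (i + 1) : ℕ)) : ZMod ((F.P K).sitesPerDir 0))) (fun k => ((((a.src k).val * F.L ^ (j + 1) : ℕ)) : ZMod ((F.P K).sitesPerDir 0))) + 2 * F.L ^ (i + 1 + 1) + m (i + 1) ≤ 8 * F.L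 ^ (j + 1)), ∀ b ∈ Finset.univ.filter (fun b : PBond (F.P K) i => blockOf b.src = c.src ∨ blockOf b.src = c.tgt), ‖BlockAveragingEMLLinearisedBackground.pertVar (Averaging.iter (fun i' => BlockAveraging.blockAvg (P := F.P K) (j := i') T3UnitLawDensityEML.ℰp) i U) (GaugeField.gaugeAct h (Averaging.iter (fun i' => BlockAveraging.blockAvg (P := F.P K) (j := i') T3UnitLawDensityEML.ℰp) i U')) b‖ ≤ σ i := by
  intro L
  by_cases hL3 : 3 ≤ L
  swap
  · refine ⟨1, one_pos, fun b₀ p₀ _ _ => ⟨1, one_pos, fun F γ hFL => ?_⟩⟩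
    exfalso
    have h3 : 3 ≤ F.L := by obtain ⟨k, hk⟩ := F.hL.1; have := F.hL.2; omega
    omega
  obtain ⟨Λ, hΛ, HR⟩ := hRegH L
  refine ⟨1, one_pos, ?_⟩
  intro b₀ p₀ hb hp
  obtain ⟨γ₃, hγ₃, HR'⟩ := HR b₀ p₀ hb hp
  have hLr3 : (3 : ℝ) ≤ (L : ℝ) := by exact_mod_cast hL3
  have hLpos : (0 : ℝ) < (L : ℝ) := by linarith
  have hsqrt_lt_one : ∀ x : ℝ, 0 ≤ x → x < 1 → Real.sqrt x < 1 := fun x hx h => by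
    rw [← Real.sqrt_one]; exact Real.sqrt_lt_sqrt hx h
  have hsqrt_le_one : ∀ x : ℝ, x ≤ 1 → Real.sqrt x ≤ 1 := fun x h => by
    rw [← Real.sqrt_one]; exact Real.sqrt_le_sqrt h
  set Cθ : ℝ := b₀ * ((2 * p₀) ^ p₀ * Real.exp (1 / 2 - p₀)) with hCθ_def
  have hCθ0 : 0 ≤ Cθ := by
    have : 0 < (2 * p₀) ^ p₀ := Real.rpow_pos_of_pos (by linarith) _
    positivity
  have hLinv0 : 0 ≤ ((L : ℝ)⁻¹) := inv_nonneg.mpr hLpos.le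
  have hLinv1 : ((L : ℝ)⁻¹) < 1 := inv_lt_one_of_one_lt₀ (by linarith)
  set ρ₀ : ℝ := Real.sqrt (Real.sqrt ((L : ℝ)⁻¹)) with hρ₀_def
  set ρ : ℝ := Real.sqrt (Real.sqrt ρ₀) with hρ_def
  have hρ₀0 : 0 ≤ ρ₀ := Real.sqrt_nonneg _
  have hρ₀1 : ρ₀ < 1 := hsqrt_lt_one _ (Real.sqrt_nonneg _) (hsqrt_lt_one _ hLinv0 hLinv1)
  have hρ0 : 0 ≤ ρ := Real.sqrt_nonneg _
  have hρ1 : ρ < 1 := hsqrt_lt_one _ (Real.sqrt_nonneg _) (hsqrt_lt_one _ hρ₀0 hρ₀1)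
  have hρsq : Real.sqrt ρ₀ = ρ ^ 2 := (Real.sq_sqrt (Real.sqrt_nonneg _)).symm
  have hρ4 : ρ₀ = ρ ^ 4 := by rw [show (4 : ℕ) = 2 * 2 from rfl, pow_mul, ← hρsq, Real.sq_sqrt hρ₀0]
  have hρ₀le : ρ₀ ≤ ρ := by rw [hρ4]; exact pow_le_of_le_one hρ0 hρ1.le (by norm_num)
  have hsρ₀le : Real.sqrt ρ₀ ≤ ρ := by rw [hρsq]; exact pow_le_of_le_one hρ0 hρ1.le (by norm_num)
  set G : ℝ := (1 - ρ)⁻¹ with hG_def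
  have hG0 : 0 < G := inv_pos.mpr (by linarith)
  have hG₀ : (1 - ρ₀)⁻¹ ≤ G := inv_anti₀ (by linarith) (by linarith)
  set Ktot : ℝ := (Real.sqrt (Real.sqrt (2 * Cθ * Λ) * Λ * Real.sqrt (L : ℝ)) + Λ * (2 * Real.sqrt (Real.sqrt Cθ) + Real.sqrt Cθ)) * G with hKtot_def
  have hK0 : 0 ≤ Ktot := by positivity
  set bud : ℝ := 1 / (10 ^ 7 * (L : ℝ) ^ 7) with hbud_def
  have hbud : 0 < bud := by positivity
  set y : ℝ := bud / (Ktot + 1) with hy_def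
  have hy0 : 0 < y := div_pos hbud (by linarith)
  refine ⟨min γ₃ (min 1 (y ^ 16)), lt_min hγ₃ (lt_min one_pos (pow_pos hy0 16)), ?_⟩
  intro F γ hFL hγ hγle K j hj hjK a U U' hwU hwU' horb0 hBx
  have hγ3 : γ ≤ γ₃ := hγle.trans (min_le_left _ _)
  have hγ1 : γ ≤ 1 := hγle.trans ((min_le_right _ _).trans (min_le_left _ _))
  have hγy : γ ≤ y ^ 16 := hγle.trans ((min_le_right _ _).trans (min_le_right _ _))
  subst hFL
  have hL1 : 1 ≤ F.L := by omega
  have hL0 : 0 < F.L := by omega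
  have hLr1 : (1 : ℝ) ≤ (F.L : ℝ) := by exact_mod_cast hL1
  set Bx : ℝ := (∑ b : PBond (F.P K) 0, if (∀ k, (b.src k - ((((a.src k).val * F.L ^ (j + 1) : ℕ)) : ZMod ((F.P K).sitesPerDir 0)) + ((8 * F.L ^ (j + 1) : ℕ) : ZMod ((F.P K).sitesPerDir 0))).val < 17 * F.L ^ (j + 1)) ∧ (∀ k, (b.tgt k - ((((a.src k).val * F.L ^ (j + 1) : ℕ)) : ZMod ((F.P K).sitesPerDir 0)) + ((8 * F.L ^ (j + 1) : ℕ) : ZMod ((F.P K).sitesPerDir 0))).val < 17 * F.L ^ (j + 1)) then GaugeGroup.dist1 (U b * (U' b)⁻¹) ^ 2 else 0) with hBx_def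
  have hBx0 : 0 ≤ Bx := Finset.sum_nonneg fun b _ => by split_ifs <;> positivity
  set θ : ℕ → ℝ := fun i => θBal F.L γ b₀ p₀ (K - i) with hθ_def
  have hθpos : ∀ i, 0 < θ i := fun i => θBal_pos hL1 hγ hγ1 hb p₀ _
  set r4 : ℝ := Real.sqrt (Real.sqrt γ) with hr4_def
  set r8 : ℝ := Real.sqrt r4 with hr8_def
  set r16 : ℝ := Real.sqrt r8 with hr16_def
  have hr40 : 0 ≤ r4 := Real.sqrt_nonneg _
  have hr41 : r4 ≤ 1 := hsqrt_le_one _ (hsqrt_le_one _ hγ1)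
  have hr80 : 0 ≤ r8 := Real.sqrt_nonneg _
  have hr81 : r8 ≤ 1 := hsqrt_le_one _ hr41
  have hr160 : 0 ≤ r16 := Real.sqrt_nonneg _
  have hr161 : r16 ≤ 1 := hsqrt_le_one _ hr81
  have hr816 : r8 ≤ r16 := by
    calc r8 = Real.sqrt r8 * Real.sqrt r8 := (Real.mul_self_sqrt hr80).symm
      _ ≤ Real.sqrt r8 * 1 := mul_le_mul_of_nonneg_left hr161 hr160
      _ = r16 := mul_one _
  set E : ℝ := Cθ * r4 with hE_def
  have hE0 : 0 ≤ E := mul_nonneg hCθ0 hr40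
  have hθle : ∀ i, θ i ≤ E * ρ₀ ^ (K - i) := by
    intro i
    have h := T3Thresholds.θBal_le_const_mul_sqrt_coupling hL1 hγ hγ1 hb.le (lt_trans two_pos hp) (K - i)
    have e : Real.sqrt (Real.sqrt (γ * ((F.L : ℝ)⁻¹) ^ (K - i))) = r4 * ρ₀ ^ (K - i) := by
      rw [Real.sqrt_mul hγ.le, Real.sqrt_mul (Real.sqrt_nonneg _), real_sqrt_pow hLinv0, real_sqrt_pow (Real.sqrt_nonneg _)]
    rw [e, ← mul_assoc] at h
    exact h
  have hθleE : ∀ i, θ i ≤ E := fun i => (hθle i).trans (mul_le_of_le_one_right hE0 (pow_le_one₀ hρ₀0 hρ₀1.le))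
  have hsθρ : ∀ i, Real.sqrt (θ i) ≤ Real.sqrt E * ρ ^ (K - i) := by
    intro i
    calc Real.sqrt (θ i) ≤ Real.sqrt (E * ρ₀ ^ (K - i)) := Real.sqrt_le_sqrt (hθle i)
      _ = Real.sqrt E * Real.sqrt ρ₀ ^ (K - i) := by rw [Real.sqrt_mul hE0, real_sqrt_pow hρ₀0]
      _ ≤ Real.sqrt E * ρ ^ (K - i) := mul_le_mul_of_nonneg_left (pow_le_pow_left₀ (Real.sqrt_nonneg _) hsρ₀le _) (Real.sqrt_nonneg _)
  have hssθρ : ∀ i, Real.sqrt (Real.sqrt (θ i)) ≤ Real.sqrt (Real.sqrt E) * ρ ^ (K - i) := by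
    intro i
    calc Real.sqrt (Real.sqrt (θ i)) ≤ Real.sqrt (Real.sqrt (E * ρ₀ ^ (K - i))) := Real.sqrt_le_sqrt (Real.sqrt_le_sqrt (hθle i))
      _ = Real.sqrt (Real.sqrt E) * ρ ^ (K - i) := by
          rw [Real.sqrt_mul hE0, real_sqrt_pow hρ₀0, Real.sqrt_mul (Real.sqrt_nonneg _), real_sqrt_pow (Real.sqrt_nonneg _)]
  set Rr : ℕ → ℝ := fun i => min ((F.L : ℝ) ^ ((j - i) / 2)) (max 1 (Real.sqrt (θ i))⁻¹) with hRr_def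
  set A : ℕ → ℝ := fun i => 2 * θ j * Real.sqrt ((F.L : ℝ) ^ (j + 1 - i)) with hA_def
  set B : ℕ → ℝ := fun i => Λ * ((Real.sqrt (Rr i))⁻¹ + Real.sqrt (θ i) * Real.sqrt (Rr i)) with hB_def
  have hRr1 : ∀ i, 1 ≤ Rr i := fun i => le_min (one_le_pow₀ hLr1) (le_max_left _ _)
  have hRr0 : ∀ i, 0 < Rr i := fun i => lt_of_lt_of_le one_pos (hRr1 i)
  have hA0 : ∀ i, 0 ≤ A i := fun i => mul_nonneg (mul_nonneg two_pos.le (hθpos j).le) (Real.sqrt_nonneg _)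
  have hB0 : ∀ i, 0 ≤ B i := fun i =>
    mul_nonneg hΛ.le (add_nonneg (inv_nonneg.mpr (Real.sqrt_nonneg _)) (mul_nonneg (Real.sqrt_nonneg _) (Real.sqrt_nonneg _)))
  have hBle : ∀ i, B i ≤ Λ * (Real.sqrt (F.L : ℝ) ^ ((j - i) / 2))⁻¹ + Λ * (2 * Real.sqrt (Real.sqrt (θ i)) + Real.sqrt (θ i)) := by
    intro i
    have hq0 : 0 < Real.sqrt (θ i) := Real.sqrt_pos.mpr (hθpos i)
    have hqq0 : 0 < Real.sqrt (Real.sqrt (θ i)) := Real.sqrt_pos.mpr hq0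
    have hP0 : 0 < (F.L : ℝ) ^ ((j - i) / 2) := pow_pos (by exact_mod_cast hL0) _
    have hQ0 : 0 < max 1 (Real.sqrt (θ i))⁻¹ := lt_of_lt_of_le one_pos (le_max_left _ _)
    have hQ1 : (Real.sqrt (max 1 (Real.sqrt (θ i))⁻¹))⁻¹ ≤ Real.sqrt (Real.sqrt (θ i)) := by
      have h1 : Real.sqrt ((Real.sqrt (θ i))⁻¹) ≤ Real.sqrt (max 1 (Real.sqrt (θ i))⁻¹) := Real.sqrt_le_sqrt (le_max_right _ _)
      rw [Real.sqrt_inv] at h1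
      calc (Real.sqrt (max 1 (Real.sqrt (θ i))⁻¹))⁻¹ ≤ ((Real.sqrt (Real.sqrt (θ i)))⁻¹)⁻¹ := inv_anti₀ (inv_pos.mpr hqq0) h1
        _ = Real.sqrt (Real.sqrt (θ i)) := inv_inv _
    have hQ2 : Real.sqrt (max 1 (Real.sqrt (θ i))⁻¹) ≤ 1 + (Real.sqrt (Real.sqrt (θ i)))⁻¹ := by
      have hy0 : 0 ≤ (Real.sqrt (Real.sqrt (θ i)))⁻¹ := inv_nonneg.mpr hqq0.le
      have hsq : ((Real.sqrt (Real.sqrt (θ i)))⁻¹) ^ 2 = (Real.sqrt (θ i))⁻¹ := by rw [inv_pow, Real.sq_sqrt hq0.le]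
      have hle : max 1 (Real.sqrt (θ i))⁻¹ ≤ (1 + (Real.sqrt (Real.sqrt (θ i)))⁻¹) ^ 2 := by
        refine max_le (by nlinarith) ?_
        rw [← hsq]; nlinarith
      calc Real.sqrt (max 1 (Real.sqrt (θ i))⁻¹) ≤ Real.sqrt ((1 + (Real.sqrt (Real.sqrt (θ i)))⁻¹) ^ 2) := Real.sqrt_le_sqrt hle
        _ = 1 + (Real.sqrt (Real.sqrt (θ i)))⁻¹ := Real.sqrt_sq (by positivity)
    have hinv : (Real.sqrt (Rr i))⁻¹ ≤ (Real.sqrt (F.L : ℝ) ^ ((j - i) / 2))⁻¹ + Real.sqrt (Real.sqrt (θ i)) := by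
      rcases min_choice ((F.L : ℝ) ^ ((j - i) / 2)) (max 1 (Real.sqrt (θ i))⁻¹) with h | h
      · show (Real.sqrt (min ((F.L : ℝ) ^ ((j - i) / 2)) (max 1 (Real.sqrt (θ i))⁻¹)))⁻¹ ≤ _
        rw [h, real_sqrt_pow (Nat.cast_nonneg _)]; exact le_add_of_nonneg_right hqq0.le
      · show (Real.sqrt (min ((F.L : ℝ) ^ ((j - i) / 2)) (max 1 (Real.sqrt (θ i))⁻¹)))⁻¹ ≤ _
        rw [h]; exact hQ1.trans (le_add_of_nonneg_left (inv_nonneg.mpr (pow_nonneg (Real.sqrt_nonneg _) _)))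
    have hsq : Real.sqrt (θ i) * Real.sqrt (Rr i) ≤ Real.sqrt (θ i) + Real.sqrt (Real.sqrt (θ i)) := by
      have h1 : Real.sqrt (Rr i) ≤ Real.sqrt (max 1 (Real.sqrt (θ i))⁻¹) := Real.sqrt_le_sqrt (min_le_right _ _)
      have h3 : Real.sqrt (θ i) * (Real.sqrt (Real.sqrt (θ i)))⁻¹ = Real.sqrt (Real.sqrt (θ i)) := by
        rw [← div_eq_mul_inv, Real.div_sqrt]
      calc Real.sqrt (θ i) * Real.sqrt (Rr i) ≤ Real.sqrt (θ i) * (1 + (Real.sqrt (Real.sqrt (θ i)))⁻¹) :=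
            mul_le_mul_of_nonneg_left (h1.trans hQ2) hq0.le
        _ = Real.sqrt (θ i) + Real.sqrt (Real.sqrt (θ i)) := by rw [mul_add, mul_one, h3]
    calc B i = Λ * ((Real.sqrt (Rr i))⁻¹ + Real.sqrt (θ i) * Real.sqrt (Rr i)) := rfl
      _ ≤ Λ * (((Real.sqrt (F.L : ℝ) ^ ((j - i) / 2))⁻¹ + Real.sqrt (Real.sqrt (θ i))) + (Real.sqrt (θ i) + Real.sqrt (Real.sqrt (θ i)))) :=
          mul_le_mul_of_nonneg_left (add_le_add hinv hsq) hΛ.le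
      _ = _ := by ring
  set c₁ : ℝ := Real.sqrt (Real.sqrt (2 * E * Λ) * Λ * Real.sqrt (F.L : ℝ)) with hc₁_def
  set c₂ : ℝ := Λ * (2 * Real.sqrt (Real.sqrt E) + Real.sqrt E) with hc₂_def
  have hc₁0 : 0 ≤ c₁ := Real.sqrt_nonneg _
  have hc₂0 : 0 ≤ c₂ := by positivity
  have hGM : ∀ i, i < j → min (A i) (Λ * (Real.sqrt (F.L : ℝ) ^ ((j - i) / 2))⁻¹) ≤
      c₁ * (Real.sqrt (Real.sqrt (Real.sqrt (F.L : ℝ))) ^ ((j - i) / 2))⁻¹ := by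
    intro i hi
    set k := (j - i) / 2 with hk
    set s := Real.sqrt (F.L : ℝ) with hs_def
    have hs1 : 1 ≤ s := by rw [hs_def, ← Real.sqrt_one]; exact Real.sqrt_le_sqrt hLr1
    have hs0 : 0 < s := lt_of_lt_of_le one_pos hs1
    have hsk : 0 < s ^ k := pow_pos hs0 _
    have hX0 : 0 ≤ Λ * (s ^ k)⁻¹ := by positivity
    refine (min_le_sqrt_sqrt_mul (hA0 i) hX0).trans ?_
    have hpow : Real.sqrt ((F.L : ℝ) ^ (j + 1 - i)) ≤ s ^ (k + 2) * s ^ k := by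
      rw [real_sqrt_pow (Nat.cast_nonneg _), ← hs_def, ← pow_add]
      exact pow_le_pow_right₀ hs1 (by omega)
    have hAX : A i * (Λ * (s ^ k)⁻¹) ≤ 2 * E * Λ * s ^ (k + 2) := by
      calc A i * (Λ * (s ^ k)⁻¹) = 2 * θ j * Real.sqrt ((F.L : ℝ) ^ (j + 1 - i)) * (Λ * (s ^ k)⁻¹) := rfl
        _ ≤ 2 * E * (s ^ (k + 2) * s ^ k) * (Λ * (s ^ k)⁻¹) := by
            refine mul_le_mul_of_nonneg_right ?_ hX0
            exact mul_le_mul (mul_le_mul_of_nonneg_left (hθleE j) two_pos.le) hpow (Real.sqrt_nonneg _) (by positivity)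
        _ = 2 * E * Λ * s ^ (k + 2) := by field_simp
    have hsqk : Real.sqrt (s ^ (k + 2)) * (s ^ k)⁻¹ = s * (Real.sqrt s ^ k)⁻¹ := by
      have hr0 : Real.sqrt s ^ k ≠ 0 := pow_ne_zero _ (Real.sqrt_pos.mpr hs0).ne'
      have e1 : Real.sqrt (s ^ (k + 2)) = Real.sqrt s ^ k * s := by
        rw [real_sqrt_pow hs0.le, pow_add, Real.sq_sqrt hs0.le]
      have e2 : s ^ k = Real.sqrt s ^ k * Real.sqrt s ^ k := by rw [← mul_pow, Real.mul_self_sqrt hs0.le]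
      rw [e1, e2, mul_inv, ← mul_assoc, mul_assoc (Real.sqrt s ^ k) s, mul_comm (Real.sqrt s ^ k) (s * (Real.sqrt s ^ k)⁻¹),
        mul_assoc, mul_inv_cancel₀ hr0, mul_one]
    calc Real.sqrt (Real.sqrt (A i * (Λ * (s ^ k)⁻¹)) * (Λ * (s ^ k)⁻¹))
        ≤ Real.sqrt (Real.sqrt (2 * E * Λ * s ^ (k + 2)) * (Λ * (s ^ k)⁻¹)) :=
          Real.sqrt_le_sqrt (mul_le_mul_of_nonneg_right (Real.sqrt_le_sqrt hAX) hX0)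
      _ = Real.sqrt ((Real.sqrt (2 * E * Λ) * Λ * s) * (Real.sqrt s ^ k)⁻¹) := by
          rw [Real.sqrt_mul (by positivity) (s ^ (k + 2)), show Real.sqrt (2 * E * Λ) * Real.sqrt (s ^ (k + 2)) * (Λ * (s ^ k)⁻¹) =
            Real.sqrt (2 * E * Λ) * Λ * (Real.sqrt (s ^ (k + 2)) * (s ^ k)⁻¹) by ring, hsqk]
          ring_nf
      _ = c₁ * (Real.sqrt (Real.sqrt s) ^ k)⁻¹ := by
          rw [Real.sqrt_mul (by positivity), Real.sqrt_inv, real_sqrt_pow (Real.sqrt_nonneg _)]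
  have hσle : ∀ i, i < j → min (A i) (B i) ≤ c₁ * (Real.sqrt (Real.sqrt (Real.sqrt (F.L : ℝ))) ^ ((j - i) / 2))⁻¹ + c₂ * ρ ^ (K - i) := by
    intro i hi
    have hY0 : 0 ≤ Λ * (2 * Real.sqrt (Real.sqrt (θ i)) + Real.sqrt (θ i)) :=
      mul_nonneg hΛ.le (add_nonneg (mul_nonneg two_pos.le (Real.sqrt_nonneg _)) (Real.sqrt_nonneg _))
    have hprof : 2 * Real.sqrt (Real.sqrt (θ i)) + Real.sqrt (θ i) ≤ (2 * Real.sqrt (Real.sqrt E) + Real.sqrt E) * ρ ^ (K - i) := by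
      have := hssθρ i; have := hsθρ i
      linarith
    calc min (A i) (B i) ≤ min (A i) (Λ * (Real.sqrt (F.L : ℝ) ^ ((j - i) / 2))⁻¹ + Λ * (2 * Real.sqrt (Real.sqrt (θ i)) + Real.sqrt (θ i))) :=
          min_le_min_left _ (hBle i)
      _ ≤ min (A i) (Λ * (Real.sqrt (F.L : ℝ) ^ ((j - i) / 2))⁻¹) + Λ * (2 * Real.sqrt (Real.sqrt (θ i)) + Real.sqrt (θ i)) := min_le_min_add hY0
      _ ≤ c₁ * (Real.sqrt (Real.sqrt (Real.sqrt (F.L : ℝ))) ^ ((j - i) / 2))⁻¹ + c₂ * ρ ^ (K - i) := by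
          refine add_le_add (hGM i hi) ?_
          calc Λ * (2 * Real.sqrt (Real.sqrt (θ i)) + Real.sqrt (θ i)) ≤ Λ * ((2 * Real.sqrt (Real.sqrt E) + Real.sqrt E) * ρ ^ (K - i)) :=
                mul_le_mul_of_nonneg_left hprof hΛ.le
            _ = c₂ * ρ ^ (K - i) := by rw [← mul_assoc]
  have hsum : ∑ i ∈ Finset.range j, min (A i) (B i) ≤ bud := by
    have hsL : 1 < Real.sqrt (Real.sqrt (Real.sqrt (F.L : ℝ))) := by
      rw [← Real.sqrt_one]; refine Real.sqrt_lt_sqrt (by norm_num) ?_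
      rw [← Real.sqrt_one]; refine Real.sqrt_lt_sqrt (by norm_num) ?_
      rw [← Real.sqrt_one]; exact Real.sqrt_lt_sqrt (by norm_num) (by linarith)
    have hS1 : ∑ i ∈ Finset.range j, (Real.sqrt (Real.sqrt (Real.sqrt (F.L : ℝ))) ^ ((j - i) / 2))⁻¹ ≤ G := by
      have h := sum_inv_pow_half_le hsL j
      have e : (Real.sqrt (Real.sqrt (Real.sqrt (Real.sqrt (F.L : ℝ)))))⁻¹ = ρ := by
        rw [hρ_def, hρ₀_def, Real.sqrt_inv, Real.sqrt_inv, Real.sqrt_inv, Real.sqrt_inv]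
      rw [e] at h
      exact h
    have hS2 : ∑ i ∈ Finset.range j, ρ ^ (K - i) ≤ G := sum_pow_sub_le hρ0 hρ1 (by omega)
    have htot : ∑ i ∈ Finset.range j, min (A i) (B i) ≤ c₁ * G + c₂ * G := by
      calc ∑ i ∈ Finset.range j, min (A i) (B i) ≤ ∑ i ∈ Finset.range j, (c₁ * (Real.sqrt (Real.sqrt (Real.sqrt (F.L : ℝ))) ^ ((j - i) / 2))⁻¹ + c₂ * ρ ^ (K - i)) :=
            Finset.sum_le_sum fun i hi => hσle i (Finset.mem_range.mp hi)
        _ = c₁ * ∑ i ∈ Finset.range j, (Real.sqrt (Real.sqrt (Real.sqrt (F.L : ℝ))) ^ ((j - i) / 2))⁻¹ + c₂ * ∑ i ∈ Finset.range j, ρ ^ (K - i) := by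
            rw [Finset.sum_add_distrib, Finset.mul_sum, Finset.mul_sum]
        _ ≤ c₁ * G + c₂ * G := add_le_add (mul_le_mul_of_nonneg_left hS1 hc₁0) (mul_le_mul_of_nonneg_left hS2 hc₂0)
    have h2C : 0 ≤ 2 * Cθ * Λ := by positivity
    have hc₁e : c₁ = Real.sqrt (Real.sqrt (2 * Cθ * Λ) * Λ * Real.sqrt (F.L : ℝ)) * r16 := by
      rw [hc₁_def, hE_def, show 2 * (Cθ * r4) * Λ = (2 * Cθ * Λ) * r4 by ring, Real.sqrt_mul h2C,
        show Real.sqrt (2 * Cθ * Λ) * Real.sqrt r4 * Λ * Real.sqrt (F.L : ℝ) = (Real.sqrt (2 * Cθ * Λ) * Λ * Real.sqrt (F.L : ℝ)) * r8 by rw [hr8_def]; ring,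
        Real.sqrt_mul (by positivity), hr16_def]
    have hc₂e : c₂ ≤ Λ * (2 * Real.sqrt (Real.sqrt Cθ) + Real.sqrt Cθ) * r16 := by
      have e1 : Real.sqrt (Real.sqrt E) = Real.sqrt (Real.sqrt Cθ) * r16 := by
        rw [hE_def, Real.sqrt_mul hCθ0, Real.sqrt_mul (Real.sqrt_nonneg _), ← hr8_def, ← hr16_def]
      have e2 : Real.sqrt E = Real.sqrt Cθ * r8 := by rw [hE_def, Real.sqrt_mul hCθ0, ← hr8_def]
      have i2 : Real.sqrt E ≤ Real.sqrt Cθ * r16 := by rw [e2]; exact mul_le_mul_of_nonneg_left hr816 (Real.sqrt_nonneg _)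
      calc c₂ = Λ * (2 * Real.sqrt (Real.sqrt E) + Real.sqrt E) := rfl
        _ ≤ Λ * (2 * (Real.sqrt (Real.sqrt Cθ) * r16) + Real.sqrt Cθ * r16) := by
            rw [e1]; exact mul_le_mul_of_nonneg_left (add_le_add le_rfl i2) hΛ.le
        _ = Λ * (2 * Real.sqrt (Real.sqrt Cθ) + Real.sqrt Cθ) * r16 := by ring
    have hK : c₁ * G + c₂ * G ≤ Ktot * r16 := by
      have : c₂ * G ≤ Λ * (2 * Real.sqrt (Real.sqrt Cθ) + Real.sqrt Cθ) * r16 * G := mul_le_mul_of_nonneg_right hc₂e hG0.le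
      rw [hc₁e]
      calc Real.sqrt (Real.sqrt (2 * Cθ * Λ) * Λ * Real.sqrt (F.L : ℝ)) * r16 * G + c₂ * G
          ≤ Real.sqrt (Real.sqrt (2 * Cθ * Λ) * Λ * Real.sqrt (F.L : ℝ)) * r16 * G + Λ * (2 * Real.sqrt (Real.sqrt Cθ) + Real.sqrt Cθ) * r16 * G :=
            add_le_add le_rfl this
        _ = Ktot * r16 := by rw [hKtot_def]; ring
    have hr16y : r16 ≤ y := by
      have e : Real.sqrt (Real.sqrt (Real.sqrt (Real.sqrt (y ^ 16)))) = y := by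
        rw [show y ^ 16 = (y ^ 8) ^ 2 by ring, Real.sqrt_sq (by positivity), show y ^ 8 = (y ^ 4) ^ 2 by ring,
          Real.sqrt_sq (by positivity), show y ^ 4 = (y ^ 2) ^ 2 by ring, Real.sqrt_sq (by positivity), Real.sqrt_sq hy0.le]
      rw [hr16_def, hr8_def, hr4_def, ← e]
      exact Real.sqrt_le_sqrt (Real.sqrt_le_sqrt (Real.sqrt_le_sqrt (Real.sqrt_le_sqrt hγy)))
    calc ∑ i ∈ Finset.range j, min (A i) (B i) ≤ Ktot * r16 := htot.trans hK
      _ ≤ (Ktot + 1) * r16 := mul_le_mul_of_nonneg_right (by linarith) hr160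
      _ ≤ (Ktot + 1) * y := mul_le_mul_of_nonneg_left hr16y (by linarith)
      _ = bud := by rw [hy_def]; field_simp
  have hbud4 : bud ≤ 1 / (10 ^ 7 * (F.L : ℝ) ^ 4) := by
    rw [hbud_def]
    exact one_div_le_one_div_of_le (by positivity) (mul_le_mul_of_nonneg_left (pow_le_pow_right₀ hLr1 (by norm_num)) (by norm_num))
  -- assemble
  have hm_succ : ∀ i, (∑ i' ∈ Finset.range (i + 1), F.L ^ (i' + (j - i') / 2)) = (∑ i' ∈ Finset.range i, F.L ^ (i' + (j - i') / 2)) + F.L ^ (i + (j - i) / 2) :=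
    fun i => Finset.sum_range_succ _ _
  refine ⟨fun i => ∑ i' ∈ Finset.range i, F.L ^ (i' + (j - i') / 2), fun i => by simp only [Finset.sum_range_succ]; exact Nat.le_add_right _ _,
    (sum_pow_margin_le hL3 j).trans (Nat.pow_le_pow_right hL0 (by omega)), fun i => min (A i) (B i), fun i hi => ⟨le_min (hA0 i) (hB0 i), ?_⟩, hsum, ?_⟩
  · exact ((Finset.single_le_sum (f := fun i => min (A i) (B i)) (fun i _ => le_min (hA0 i) (hB0 i)) (Finset.mem_range.mpr hi)).trans hsum).trans hbud4
  -- the chart at every level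
  intro i hi h hmin hsq c hc b hbN
  rw [Finset.mem_filter] at hc hbN
  have hx : blockOf b.src = c.src.unshift c.dir ∨ blockOf b.src = c.src ∨ blockOf b.src = c.src.shift c.dir := by
    rcases hbN.2 with h' | h'
    · exact Or.inr (Or.inl h')
    · exact Or.inr (Or.inr h')
  -- (a) the `ℓ²` bound: `‖Y b‖ ≤ √(4L^{-i}Bx) ≤ A_i`
  have hbS : b ∈ Finset.univ.filter (fun b : PBond (F.P K) i => Site.tdist (fun k => ((((b.src k).val * F.L ^ i : ℕ)) : ZMod ((F.P K).sitesPerDir 0))) (fun k => ((((a.src k).val * F.L ^ (j + 1) : ℕ)) : ZMod ((F.P K).sitesPerDir 0))) + 2 * F.L ^ (i + 1) + (∑ i' ∈ Finset.range i, F.L ^ (i' + (j - i') / 2)) ≤ 8 * F.L ^ (j + 1)) := by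
    rw [Finset.mem_filter]
    refine ⟨Finset.mem_univ _, ?_⟩
    have h0 := room_of_mem F K (by omega) a.src (m := fun i => ∑ i' ∈ Finset.range i, F.L ^ (i' + (j - i') / 2)) (r := 0)
      (by rw [hm_succ]; omega) c.src c.dir hc.2 b.src hx
    simpa using h0
  have hbound1 : ‖BlockAveragingEMLLinearisedBackground.pertVar (Averaging.iter (fun i' => BlockAveraging.blockAvg (P := F.P K) (j := i') T3UnitLawDensityEML.ℰp) i U) (GaugeField.gaugeAct h (Averaging.iter (fun i' => BlockAveraging.blockAvg (P := F.P K) (j := i') T3UnitLawDensityEML.ℰp) i U')) b‖ ≤ A i := by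
    have h1 := norm_le_sqrt_of_mem hbS hsq
    refine h1.trans ?_
    have hBx2 : Bx ≤ (F.L : ℝ) ^ (j + 1) * θ j ^ 2 := by
      have h' : Real.sqrt Bx ≤ Real.sqrt ((F.L : ℝ) ^ (j + 1)) * θ j := by have := hBx; rw [one_mul] at this; exact this
      calc Bx = Real.sqrt Bx ^ 2 := (Real.sq_sqrt hBx0).symm
        _ ≤ (Real.sqrt ((F.L : ℝ) ^ (j + 1)) * θ j) ^ 2 := pow_le_pow_left₀ (Real.sqrt_nonneg _) h' 2
        _ = (F.L : ℝ) ^ (j + 1) * θ j ^ 2 := by rw [mul_pow, Real.sq_sqrt (by positivity)]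
    have hLi : 0 < (F.L : ℝ) ^ i := pow_pos (by exact_mod_cast hL0) _
    have hAsq : 4 * ((F.L : ℝ) ^ i)⁻¹ * Bx ≤ A i ^ 2 := by
      calc 4 * ((F.L : ℝ) ^ i)⁻¹ * Bx ≤ 4 * ((F.L : ℝ) ^ i)⁻¹ * ((F.L : ℝ) ^ (j + 1) * θ j ^ 2) :=
            mul_le_mul_of_nonneg_left hBx2 (by positivity)
        _ = A i ^ 2 := by
            rw [hA_def]
            simp only
            rw [mul_pow, mul_pow, Real.sq_sqrt (by positivity), show (F.L : ℝ) ^ (j + 1) = (F.L : ℝ) ^ (j + 1 - i) * (F.L : ℝ) ^ i by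
              rw [← pow_add]; congr 1; omega]
            field_simp
            ring
    calc Real.sqrt (4 * ((F.L : ℝ) ^ i)⁻¹ * Bx) ≤ Real.sqrt (A i ^ 2) := Real.sqrt_le_sqrt hAsq
      _ = A i := Real.sqrt_sq (hA0 i)
  -- (b) the ε-regularity bound with room `R_i`
  have hbound2 : ‖BlockAveragingEMLLinearisedBackground.pertVar (Averaging.iter (fun i' => BlockAveraging.blockAvg (P := F.P K) (j := i') T3UnitLawDensityEML.ℰp) i U) (GaugeField.gaugeAct h (Averaging.iter (fun i' => BlockAveraging.blockAvg (P := F.P K) (j := i') T3UnitLawDensityEML.ℰp) i U')) b‖ ≤ B i := by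
    have hroomN := room_of_mem F K (by omega) a.src (m := fun i => ∑ i' ∈ Finset.range i, F.L ^ (i' + (j - i') / 2)) (r := F.L ^ (i + (j - i) / 2))
      (by rw [hm_succ]) c.src c.dir hc.2 b.src hx
    have hroomR : ((Site.tdist (fun k => ((((b.src k).val * F.L ^ i : ℕ)) : ZMod ((F.P K).sitesPerDir 0))) (fun k => ((((a.src k).val * F.L ^ (j + 1) : ℕ)) : ZMod ((F.P K).sitesPerDir 0))) : ℕ) : ℝ) + Rr i * (F.L : ℝ) ^ i + 2 * (F.L : ℝ) ^ (i + 1) + ((∑ i' ∈ Finset.range i, F.L ^ (i' + (j - i') / 2) : ℕ) : ℝ) ≤ 8 * (F.L : ℝ) ^ (j + 1) := by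
      have hcast : ((Site.tdist (fun k => ((((b.src k).val * F.L ^ i : ℕ)) : ZMod ((F.P K).sitesPerDir 0))) (fun k => ((((a.src k).val * F.L ^ (j + 1) : ℕ)) : ZMod ((F.P K).sitesPerDir 0))) : ℕ) : ℝ) + (F.L : ℝ) ^ (i + (j - i) / 2) + 2 * (F.L : ℝ) ^ (i + 1) + ((∑ i' ∈ Finset.range i, F.L ^ (i' + (j - i') / 2) : ℕ) : ℝ) ≤ 8 * (F.L : ℝ) ^ (j + 1) := by
        have h := (Nat.cast_le (α := ℝ)).mpr hroomN
        simpa only [Nat.cast_add, Nat.cast_ofNat, Nat.cast_mul (2 : ℕ), Nat.cast_mul (8 : ℕ), Nat.cast_pow F.L] using h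
      have hRL : Rr i * (F.L : ℝ) ^ i ≤ (F.L : ℝ) ^ (i + (j - i) / 2) := by
        calc Rr i * (F.L : ℝ) ^ i ≤ (F.L : ℝ) ^ ((j - i) / 2) * (F.L : ℝ) ^ i :=
              mul_le_mul_of_nonneg_right (min_le_left _ _) (by positivity)
          _ = (F.L : ℝ) ^ (i + (j - i) / 2) := by rw [← pow_add, add_comm]
      linarith
    exact HR' F γ rfl hγ hγ3 K j hj hjK a U U' hwU hwU' i hi _ h hmin b (Rr i) (hRr1 i) hroomR
  exact le_min hbound1 hbound2

/-! ## §4 h⋆, the registered stub, and the route crux `BlockLipschitzL` from the Hölder socket -/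

/-- ★★★ **hStab⋆'s ROW FROM LOC-REG-MIN-H** (§3 ∘ ✓`avgStability_star_of_charts`). [cite: Balaban1985Averaging, Props 1-3 (122)-(126) p.36] -/
theorem avgStability_star_of_orbitMinHolderRegularity
    (hRegH : open Literature.MathematicalPhysics.QuantumFieldTheory.Balaban1983to89 Literature.MathematicalPhysics.QuantumFieldTheory.Balaban1983to89.T3ContinuumYM3Torus in ∀ (L : ℕ), ∃ Λ : ℝ, 0 < Λ ∧ ∀ (b₀ p₀ : ℝ), 0 < b₀ → 2 < p₀ → ∃ γ₃ : ℝ, 0 < γ₃ ∧ ∀ (F : T3Family) (γ : ℝ), F.L = L → 0 < γ → γ ≤ γ₃ → ∀ (K j : ℕ), 1 ≤ j → j + 3 ≤ K → ∀ (a : Plaq (F.P K) (j + 1)) (U U' : GaugeField (F.P K) 0 (Matrix.specialUnitaryGroup (Fin 2) ℂ)), (∀ (i : ℕ) (q : Plaq (F.P K) i), i < j + 1 → Site.tdist (fun k => ((((q.src k).val * F.L ^ i : ℕ)) : ZMod ((F.P K).sitesPerDir 0))) (fun k => ((((a.src k).val * F.L ^ (j + 1) : ℕ)) : ZMod ((F.P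 K).sitesPerDir 0))) + 64 * F.L ^ i ≤ 64 * F.L ^ (j + 1) → GaugeGroup.dist1 (GaugeField.plaqHol (Averaging.iter (fun i' => BlockAveraging.blockAvg (P := F.P K) (j := i') T3UnitLawDensityEML.ℰp) i U) q) < T3UnitScaleTilt.θBal F.L γ b₀ p₀ (K - i)) → (∀ (i : ℕ) (q : Plaq (F.P K) i), i < j + 1 → Site.tdist (fun k => ((((q.src k).val * F.L ^ i : ℕ)) : ZMod ((F.P K).sitesPerDir 0))) (fun k => ((((a.src k).val * F.L ^ (j + 1) : ℕ)) : ZMod ((F.P K).sitesPerDir 0))) + 64 * F.L ^ i ≤ 64 * F.L ^ (j + 1) → GaugeGroup.dist1 (GaugeField.plaqHol (Averaging.iter (fun i' => BlockAveraging.blockAvg (P := F.P K) (j := i') T3UnitLawDensityEML.ℰp) i U') q) < T3UnitScaleTilt.θBal F.L γ b₀ p₀ (K - i)) → ∀ (i : ℕ), i < j → ∀ (M : ℕ) (h : GaugeTransf (F.P K) i (Matrix.specialUnitaryGroup (Fin 2) ℂ)), (∀ k' : GaugeTransf (F.P K) i (Matrix.specialUnitaryGroup (Fin 2) ℂ), (∑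 b : PBond (F.P K) i, if b ∈ Finset.univ.filter (fun b : PBond (F.P K) i => Site.tdist (fun k => ((((b.src k).val * F.L ^ i : ℕ)) : ZMod ((F.P K).sitesPerDir 0))) (fun k => ((((a.src k).val * F.L ^ (j + 1) : ℕ)) : ZMod ((F.P K).sitesPerDir 0))) + 2 * F.L ^ (i + 1) + M ≤ 8 * F.L ^ (j + 1)) then GaugeGroup.dist1 (Averaging.iter (fun i' => BlockAveraging.blockAvg (P := F.P K) (j := i') T3UnitLawDensityEML.ℰp) i U b * (GaugeField.gaugeAct h (Averaging.iter (fun i' => BlockAveraging.blockAvg (P := F.P K) (j := i') T3UnitLawDensityEML.ℰp) i U') b)⁻¹) ^ 2 else 0) ≤ ∑ b : PBond (F.P K) i, if b ∈ Finset.univ.filter (fun b : PBond (F.P K) i => Site.tdist (fun k => ((((b.src k).val * F.L ^ i : ℕ)) : ZMod ((F.P K).sitesPerDir 0))) (fun k => ((((a.src k).val * F.L ^ (j + 1) : ℕ)) : ZMod ((F.P K).sitesPerDir 0))) + 2 * F.L ^ (i + 1) + M ≤ 8 * F.L ^ (j + 1)) then GaugeGroup.dist1 (Averaging.iter (fun i'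 => BlockAveraging.blockAvg (P := F.P K) (j := i') T3UnitLawDensityEML.ℰp) i U b * (GaugeField.gaugeAct k' (GaugeField.gaugeAct h (Averaging.iter (fun i' => BlockAveraging.blockAvg (P := F.P K) (j := i') T3UnitLawDensityEML.ℰp) i U')) b)⁻¹) ^ 2 else 0) → ∀ (b : PBond (F.P K) i) (R : ℝ), 1 ≤ R → ((Site.tdist (fun k => ((((b.src k).val * F.L ^ i : ℕ)) : ZMod ((F.P K).sitesPerDir 0))) (fun k => ((((a.src k).val * F.L ^ (j + 1) : ℕ)) : ZMod ((F.P K).sitesPerDir 0))) : ℕ) : ℝ) + R * (F.L : ℝ) ^ i + 2 * (F.L : ℝ) ^ (i + 1) + (M : ℝ) ≤ 8 * (F.L : ℝ) ^ (j + 1) → ‖BlockAveragingEMLLinearisedBackground.pertVar (Averaging.iter (fun i' => BlockAveraging.blockAvg (P := F.P K) (j := i') T3UnitLawDensityEML.ℰp) i U) (GaugeField.gaugeAct h (Averaging.iter (fun i' => BlockAveraging.blockAvg (P := F.P K) (j := i') T3UnitLawDensityEML.ℰp) i U')) b‖ ≤ Λ * ((Real.sqrt R)⁻¹ + Real.sqrt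 (T3UnitScaleTilt.θBal F.L γ b₀ p₀ (K - i)) * Real.sqrt R)) :
    open Literature.MathematicalPhysics.QuantumFieldTheory.Balaban1983to89 Literature.MathematicalPhysics.QuantumFieldTheory.Balaban1983to89.T3ContinuumYM3Torus in ∀ (L : ℕ), ∃ T : ℝ, 0 < T ∧ ∃ CS : ℝ, 0 ≤ CS ∧ ∀ (b₀ p₀ : ℝ), 0 < b₀ → 2 < p₀ → ∃ γ₁ : ℝ, 0 < γ₁ ∧ γ₁ ≤ 1 ∧ ∀ (F : T3Family) (γ : ℝ), F.L = L → 0 < γ → γ ≤ γ₁ → ∀ (K j : ℕ), 1 ≤ j → j + 3 ≤ K → ∀ (a : Plaq (F.P K) (j + 1)) (U U' : GaugeField (F.P K) 0 (Matrix.specialUnitaryGroup (Fin 2) ℂ)), (∀ (i : ℕ) (q : Plaq (F.P K) i), i < j + 1 → Site.tdist (fun k => ((((q.src k).val * F.L ^ i : ℕ)) : ZMod ((F.P K).sitesPerDir 0))) (fun k => ((((a.src k).val * F.L ^ (j + 1) : ℕ)) : ZMod ((F.P K).sitesPerDir 0))) + 64 * F.L ^ i ≤ 64 * F.L ^ (j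 + 1) → GaugeGroup.dist1 (GaugeField.plaqHol (Averaging.iter (fun i' => BlockAveraging.blockAvg (P := F.P K) (j := i') T3UnitLawDensityEML.ℰp) i U) q) < T3UnitScaleTilt.θBal F.L γ b₀ p₀ (K - i)) → (∀ (i : ℕ) (q : Plaq (F.P K) i), i < j + 1 → Site.tdist (fun k => ((((q.src k).val * F.L ^ i : ℕ)) : ZMod ((F.P K).sitesPerDir 0))) (fun k => ((((a.src k).val * F.L ^ (j + 1) : ℕ)) : ZMod ((F.P K).sitesPerDir 0))) + 64 * F.L ^ i ≤ 64 * F.L ^ (j + 1) → GaugeGroup.dist1 (GaugeField.plaqHol (Averaging.iter (fun i' => BlockAveraging.blockAvg (P := F.P K) (j := i') T3UnitLawDensityEML.ℰp) i U') q) < T3UnitScaleTilt.θBal F.L γ b₀ p₀ (K - i)) → (∀ k : GaugeTransf (F.P K) 0 (Matrix.specialUnitaryGroup (Fin 2) ℂ), (∑ b : PBond (F.P K) 0, if (∀ k, (b.src k - ((((a.src k).val * F.L ^ (j + 1) : ℕ)) : ZMod ((F.P K).sitesPerDir 0)) + ((8 * F.L ^ (j + 1) : ℕ) : ZMod ((F.P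 K).sitesPerDir 0))).val < 17 * F.L ^ (j + 1)) ∧ (∀ k, (b.tgt k - ((((a.src k).val * F.L ^ (j + 1) : ℕ)) : ZMod ((F.P K).sitesPerDir 0)) + ((8 * F.L ^ (j + 1) : ℕ) : ZMod ((F.P K).sitesPerDir 0))).val < 17 * F.L ^ (j + 1)) then GaugeGroup.dist1 (U b * (U' b)⁻¹) ^ 2 else 0) ≤ (∑ b : PBond (F.P K) 0, if (∀ k, (b.src k - ((((a.src k).val * F.L ^ (j + 1) : ℕ)) : ZMod ((F.P K).sitesPerDir 0)) + ((8 * F.L ^ (j + 1) : ℕ) : ZMod ((F.P K).sitesPerDir 0))).val < 17 * F.L ^ (j + 1)) ∧ (∀ k, (b.tgt k - ((((a.src k).val * F.L ^ (j + 1) : ℕ)) : ZMod ((F.P K).sitesPerDir 0)) + ((8 * F.L ^ (j + 1) : ℕ) : ZMod ((F.P K).sitesPerDir 0))).val < 17 * F.L ^ (j + 1)) then GaugeGroup.dist1 (U b * (GaugeField.gaugeAct k U' b)⁻¹) ^ 2 else 0)) → Real.sqrt (∑ b : PBond (F.P K) 0, if (∀ k, (b.src k - ((((a.src k).val * F.L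 ^ (j + 1) : ℕ)) : ZMod ((F.P K).sitesPerDir 0)) + ((8 * F.L ^ (j + 1) : ℕ) : ZMod ((F.P K).sitesPerDir 0))).val < 17 * F.L ^ (j + 1)) ∧ (∀ k, (b.tgt k - ((((a.src k).val * F.L ^ (j + 1) : ℕ)) : ZMod ((F.P K).sitesPerDir 0)) + ((8 * F.L ^ (j + 1) : ℕ) : ZMod ((F.P K).sitesPerDir 0))).val < 17 * F.L ^ (j + 1)) then GaugeGroup.dist1 (U b * (U' b)⁻¹) ^ 2 else 0) ≤ T * Real.sqrt ((F.L : ℝ) ^ (j + 1)) * T3UnitScaleTilt.θBal F.L γ b₀ p₀ (K - j) → ∃ h : GaugeTransf (F.P K) j (Matrix.specialUnitaryGroup (Fin 2) ℂ), ∀ c : PBond (F.P K) (j + 1), (c = ⟨a.src, a.μ⟩ ∨ c = ⟨a.src.shift a.μ, a.ν⟩ ∨ c = ⟨a.src.shift a.ν, a.μ⟩ ∨ c = ⟨a.src, a.ν⟩) → ∀ b : PBond (F.P K) j, (blockOf b.src = c.src ∨ blockOf b.src = c.tgt) → (blockOf b.tgt = c.src ∨ blockOf b.tgt = c.tgt)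 → GaugeGroup.dist1 (Averaging.iter (fun i' => BlockAveraging.blockAvg (P := F.P K) (j := i') T3UnitLawDensityEML.ℰp) j U b * (GaugeField.gaugeAct h (Averaging.iter (fun i' => BlockAveraging.blockAvg (P := F.P K) (j := i') T3UnitLawDensityEML.ℰp) j U') b)⁻¹) ≤ CS / Real.sqrt ((F.L : ℝ) ^ (j + 1)) * Real.sqrt (∑ b : PBond (F.P K) 0, if (∀ k, (b.src k - ((((a.src k).val * F.L ^ (j + 1) : ℕ)) : ZMod ((F.P K).sitesPerDir 0)) + ((8 * F.L ^ (j + 1) : ℕ) : ZMod ((F.P K).sitesPerDir 0))).val < 17 * F.L ^ (j + 1)) ∧ (∀ k, (b.tgt k - ((((a.src k).val * F.L ^ (j + 1) : ℕ)) : ZMod ((F.P K).sitesPerDir 0)) + ((8 * F.L ^ (j + 1) : ℕ) : ZMod ((F.P K).sitesPerDir 0))).val < 17 * F.L ^ (j + 1)) then GaugeGroup.dist1 (U b * (U' b)⁻¹) ^ 2 else 0) :=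
  avgStability_star_of_charts (charts_of_orbitMinHolderRegularity hRegH)

/-- ★★★ **`stub_iteratedLipschitz` FROM LOC-REG-MIN-H** (§3 ∘ ✓`stub_iteratedLipschitz_of_charts`): the registered `j ≥ 2` stub of line `poincare_lipschitz`
VERBATIM, modulo the Hölder socket. [cite: Balaban1987RG1, (0.4) p.253] -/
theorem stub_iteratedLipschitz_of_orbitMinHolderRegularity
    (hRegH : open Literature.MathematicalPhysics.QuantumFieldTheory.Balaban1983to89 Literature.MathematicalPhysics.QuantumFieldTheory.Balaban1983to89.T3ContinuumYM3Torus in ∀ (L : ℕ), ∃ Λ : ℝ, 0 < Λ ∧ ∀ (b₀ p₀ : ℝ), 0 < b₀ → 2 < p₀ → ∃ γ₃ : ℝ, 0 < γ₃ ∧ ∀ (F : T3Family) (γ : ℝ), F.L = L → 0 < γ → γ ≤ γ₃ → ∀ (K j : ℕ), 1 ≤ j → j + 3 ≤ K → ∀ (a : Plaq (F.P K) (j + 1)) (U U' : GaugeField (F.P K) 0 (Matrix.specialUnitaryGroup (Fin 2) ℂ)), (∀ (i : ℕ) (q : Plaq (F.P K) i), i < j + 1 → Site.tdist (fun k => ((((q.src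 k).val * F.L ^ i : ℕ)) : ZMod ((F.P K).sitesPerDir 0))) (fun k => ((((a.src k).val * F.L ^ (j + 1) : ℕ)) : ZMod ((F.P K).sitesPerDir 0))) + 64 * F.L ^ i ≤ 64 * F.L ^ (j + 1) → GaugeGroup.dist1 (GaugeField.plaqHol (Averaging.iter (fun i' => BlockAveraging.blockAvg (P := F.P K) (j := i') T3UnitLawDensityEML.ℰp) i U) q) < T3UnitScaleTilt.θBal F.L γ b₀ p₀ (K - i)) → (∀ (i : ℕ) (q : Plaq (F.P K) i), i < j + 1 → Site.tdist (fun k => ((((q.src k).val * F.L ^ i : ℕ)) : ZMod ((F.P K).sitesPerDir 0))) (fun k => ((((a.src k).val * F.L ^ (j + 1) : ℕ)) : ZMod ((F.P K).sitesPerDir 0))) + 64 * F.L ^ i ≤ 64 * F.L ^ (j + 1) → GaugeGroup.dist1 (GaugeField.plaqHol (Averaging.iter (fun i' => BlockAveraging.blockAvg (P := F.P K) (j := i') T3UnitLawDensityEML.ℰp) i U') q) < T3UnitScaleTilt.θBal F.L γ b₀ p₀ (K - i)) → ∀ (i : ℕ), i < j → ∀ (M : ℕ) (h : GaugeTransf (F.P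 K) i (Matrix.specialUnitaryGroup (Fin 2) ℂ)), (∀ k' : GaugeTransf (F.P K) i (Matrix.specialUnitaryGroup (Fin 2) ℂ), (∑ b : PBond (F.P K) i, if b ∈ Finset.univ.filter (fun b : PBond (F.P K) i => Site.tdist (fun k => ((((b.src k).val * F.L ^ i : ℕ)) : ZMod ((F.P K).sitesPerDir 0))) (fun k => ((((a.src k).val * F.L ^ (j + 1) : ℕ)) : ZMod ((F.P K).sitesPerDir 0))) + 2 * F.L ^ (i + 1) + M ≤ 8 * F.L ^ (j + 1)) then GaugeGroup.dist1 (Averaging.iter (fun i' => BlockAveraging.blockAvg (P := F.P K) (j := i') T3UnitLawDensityEML.ℰp) i U b * (GaugeField.gaugeAct h (Averaging.iter (fun i' => BlockAveraging.blockAvg (P := F.P K) (j := i') T3UnitLawDensityEML.ℰp) i U') b)⁻¹) ^ 2 else 0) ≤ ∑ b : PBond (F.P K) i, if b ∈ Finset.univ.filter (fun b : PBond (F.P K) i => Site.tdist (fun k => ((((b.src k).val * F.L ^ i : ℕ)) : ZMod ((F.P K).sitesPerDir 0))) (fun k => ((((a.src k).val * F.L ^ (j + 1) : ℕ)) : ZMod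 ((F.P K).sitesPerDir 0))) + 2 * F.L ^ (i + 1) + M ≤ 8 * F.L ^ (j + 1)) then GaugeGroup.dist1 (Averaging.iter (fun i' => BlockAveraging.blockAvg (P := F.P K) (j := i') T3UnitLawDensityEML.ℰp) i U b * (GaugeField.gaugeAct k' (GaugeField.gaugeAct h (Averaging.iter (fun i' => BlockAveraging.blockAvg (P := F.P K) (j := i') T3UnitLawDensityEML.ℰp) i U')) b)⁻¹) ^ 2 else 0) → ∀ (b : PBond (F.P K) i) (R : ℝ), 1 ≤ R → ((Site.tdist (fun k => ((((b.src k).val * F.L ^ i : ℕ)) : ZMod ((F.P K).sitesPerDir 0))) (fun k => ((((a.src k).val * F.L ^ (j + 1) : ℕ)) : ZMod ((F.P K).sitesPerDir 0))) : ℕ) : ℝ) + R * (F.L : ℝ) ^ i + 2 * (F.L : ℝ) ^ (i + 1) + (M : ℝ) ≤ 8 * (F.L : ℝ) ^ (j + 1) → ‖BlockAveragingEMLLinearisedBackground.pertVar (Averaging.iter (fun i' => BlockAveraging.blockAvg (P := F.P K) (j := i') T3UnitLawDensityEML.ℰp) i U) (GaugeField.gaugeAct h (Averaging.iter (fun i'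 => BlockAveraging.blockAvg (P := F.P K) (j := i') T3UnitLawDensityEML.ℰp) i U')) b‖ ≤ Λ * ((Real.sqrt R)⁻¹ + Real.sqrt (T3UnitScaleTilt.θBal F.L γ b₀ p₀ (K - i)) * Real.sqrt R)) :
    open Literature.MathematicalPhysics.QuantumFieldTheory.Balaban1983to89 Literature.MathematicalPhysics.QuantumFieldTheory.Balaban1983to89.T3ContinuumYM3Torus in ∀ (L : ℕ), ∃ CL : ℝ, 0 ≤ CL ∧ ∀ (b₀ p₀ : ℝ), 0 < b₀ → 2 < p₀ → ∃ γ₁ : ℝ, 0 < γ₁ ∧ γ₁ ≤ 1 ∧ ∀ (F : T3Family) (γ : ℝ), F.L = L → 0 < γ → γ ≤ γ₁ → ∀ (K j : ℕ), 1 ≤ j → j + 2 ≤ K → 2 ≤ j → ∀ (a : Plaq (F.P K) j) (U U' : GaugeField (F.P K) 0 (Matrix.specialUnitaryGroup (Fin 2) ℂ)), (∀ (i : ℕ) (q : Plaq (F.P K) i), i < j → Site.tdist (fun k => ((((q.src k).val * F.L ^ i : ℕ)) : ZMod ((F.P K).sitesPerDir 0))) (fun k => ((((a.src k).val * F.L ^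 j : ℕ)) : ZMod ((F.P K).sitesPerDir 0))) + 64 * F.L ^ i ≤ 64 * F.L ^ j → GaugeGroup.dist1 (GaugeField.plaqHol (Averaging.iter (fun i' => BlockAveraging.blockAvg (P := F.P K) (j := i') T3UnitLawDensityEML.ℰp) i U) q) < T3UnitScaleTilt.θBal F.L γ b₀ p₀ (K - i)) → (∀ (i : ℕ) (q : Plaq (F.P K) i), i < j → Site.tdist (fun k => ((((q.src k).val * F.L ^ i : ℕ)) : ZMod ((F.P K).sitesPerDir 0))) (fun k => ((((a.src k).val * F.L ^ j : ℕ)) : ZMod ((F.P K).sitesPerDir 0))) + 64 * F.L ^ i ≤ 64 * F.L ^ j → GaugeGroup.dist1 (GaugeField.plaqHol (Averaging.iter (fun i' => BlockAveraging.blockAvg (P := F.P K) (j := i') T3UnitLawDensityEML.ℰp) i U') q) < T3UnitScaleTilt.θBal F.L γ b₀ p₀ (K - i)) → |GaugeGroup.dist1 (GaugeField.plaqHol (Averaging.iter (fun i' => BlockAveraging.blockAvg (P := F.P K) (j := i') T3UnitLawDensityEML.ℰp) j U) a) - GaugeGroup.dist1 (GaugeField.plaqHol (Averaging.iter (fun i'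 => BlockAveraging.blockAvg (P := F.P K) (j := i') T3UnitLawDensityEML.ℰp) j U') a)| ≤ CL / Real.sqrt ((F.L : ℝ) ^ j) * Real.sqrt (∑ b : PBond (F.P K) 0, if (∀ k, (b.src k - ((((a.src k).val * F.L ^ j : ℕ)) : ZMod ((F.P K).sitesPerDir 0)) + ((8 * F.L ^ j : ℕ) : ZMod ((F.P K).sitesPerDir 0))).val < 17 * F.L ^ j) ∧ (∀ k, (b.tgt k - ((((a.src k).val * F.L ^ j : ℕ)) : ZMod ((F.P K).sitesPerDir 0)) + ((8 * F.L ^ j : ℕ) : ZMod ((F.P K).sitesPerDir 0))).val < 17 * F.L ^ j) then GaugeGroup.dist1 (U b * (U' b)⁻¹) ^ 2 else 0) :=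
  stub_iteratedLipschitz_of_charts (charts_of_orbitMinHolderRegularity hRegH)

/-- ★★★ **`BlockLipschitzL` ⟸ LOC-REG-MIN-H** (stmt-QuantumFields-23533 BY NAME, modulo the Hölder socket): the `j = 1` rung is ✓`stub_levelOneLipschitz`,
the `j ≥ 2` rung is `stub_iteratedLipschitz_of_orbitMinHolderRegularity hRegH`; merged with `CL := max CL₁ CL₂`, `γ₁ := min γ₁ γ₂` exactly as
✓`PoincareLipschitzBlockLipschitzLOfDeepLowCharts.blockLipschitzL_of_deepLowCharts`. [cite: Balaban1987RG1, (0.4) p.253; SchoenUhlenbeck1982, Thm IV] -/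
theorem blockLipschitzL_of_orbitMinHolderRegularity
    (hRegH : open Literature.MathematicalPhysics.QuantumFieldTheory.Balaban1983to89 Literature.MathematicalPhysics.QuantumFieldTheory.Balaban1983to89.T3ContinuumYM3Torus in ∀ (L : ℕ), ∃ Λ : ℝ, 0 < Λ ∧ ∀ (b₀ p₀ : ℝ), 0 < b₀ → 2 < p₀ → ∃ γ₃ : ℝ, 0 < γ₃ ∧ ∀ (F : T3Family) (γ : ℝ), F.L = L → 0 < γ → γ ≤ γ₃ → ∀ (K j : ℕ), 1 ≤ j → j + 3 ≤ K → ∀ (a : Plaq (F.P K) (j + 1)) (U U' : GaugeField (F.P K) 0 (Matrix.specialUnitaryGroup (Fin 2) ℂ)), (∀ (i : ℕ) (q : Plaq (F.P K) i), i < j + 1 → Site.tdist (fun k => ((((q.src k).val * F.L ^ i : ℕ)) : ZMod ((F.P K).sitesPerDir 0))) (fun k => ((((a.src k).val * F.L ^ (j + 1) : ℕ)) : ZMod ((F.P K).sitesPerDir 0))) + 64 * F.L ^ i ≤ 64 * F.L ^ (j + 1) → GaugeGroup.dist1 (GaugeField.plaqHol (Averaging.iter (fun i' => BlockAveraging.blockAvg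 (P := F.P K) (j := i') T3UnitLawDensityEML.ℰp) i U) q) < T3UnitScaleTilt.θBal F.L γ b₀ p₀ (K - i)) → (∀ (i : ℕ) (q : Plaq (F.P K) i), i < j + 1 → Site.tdist (fun k => ((((q.src k).val * F.L ^ i : ℕ)) : ZMod ((F.P K).sitesPerDir 0))) (fun k => ((((a.src k).val * F.L ^ (j + 1) : ℕ)) : ZMod ((F.P K).sitesPerDir 0))) + 64 * F.L ^ i ≤ 64 * F.L ^ (j + 1) → GaugeGroup.dist1 (GaugeField.plaqHol (Averaging.iter (fun i' => BlockAveraging.blockAvg (P := F.P K) (j := i') T3UnitLawDensityEML.ℰp) i U') q) < T3UnitScaleTilt.θBal F.L γ b₀ p₀ (K - i)) → ∀ (i : ℕ), i < j → ∀ (M : ℕ) (h : GaugeTransf (F.P K) i (Matrix.specialUnitaryGroup (Fin 2) ℂ)), (∀ k' : GaugeTransf (F.P K) i (Matrix.specialUnitaryGroup (Fin 2) ℂ), (∑ b : PBond (F.P K) i, if b ∈ Finset.univ.filter (fun b : PBond (F.P K) i => Site.tdist (fun k => ((((b.src k).val * F.L ^ i : ℕ)) : ZMod ((F.P K).sitesPerDir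 0))) (fun k => ((((a.src k).val * F.L ^ (j + 1) : ℕ)) : ZMod ((F.P K).sitesPerDir 0))) + 2 * F.L ^ (i + 1) + M ≤ 8 * F.L ^ (j + 1)) then GaugeGroup.dist1 (Averaging.iter (fun i' => BlockAveraging.blockAvg (P := F.P K) (j := i') T3UnitLawDensityEML.ℰp) i U b * (GaugeField.gaugeAct h (Averaging.iter (fun i' => BlockAveraging.blockAvg (P := F.P K) (j := i') T3UnitLawDensityEML.ℰp) i U') b)⁻¹) ^ 2 else 0) ≤ ∑ b : PBond (F.P K) i, if b ∈ Finset.univ.filter (fun b : PBond (F.P K) i => Site.tdist (fun k => ((((b.src k).val * F.L ^ i : ℕ)) : ZMod ((F.P K).sitesPerDir 0))) (fun k => ((((a.src k).val * F.L ^ (j + 1) : ℕ)) : ZMod ((F.P K).sitesPerDir 0))) + 2 * F.L ^ (i + 1) + M ≤ 8 * F.L ^ (j + 1)) then GaugeGroup.dist1 (Averaging.iter (fun i' => BlockAveraging.blockAvg (P := F.P K) (j := i') T3UnitLawDensityEML.ℰp) i U b * (GaugeField.gaugeAct k' (GaugeField.gaugeAct h (Averaging.iter (fun i' => BlockAveraging.blockAvg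 (P := F.P K) (j := i') T3UnitLawDensityEML.ℰp) i U')) b)⁻¹) ^ 2 else 0) → ∀ (b : PBond (F.P K) i) (R : ℝ), 1 ≤ R → ((Site.tdist (fun k => ((((b.src k).val * F.L ^ i : ℕ)) : ZMod ((F.P K).sitesPerDir 0))) (fun k => ((((a.src k).val * F.L ^ (j + 1) : ℕ)) : ZMod ((F.P K).sitesPerDir 0))) : ℕ) : ℝ) + R * (F.L : ℝ) ^ i + 2 * (F.L : ℝ) ^ (i + 1) + (M : ℝ) ≤ 8 * (F.L : ℝ) ^ (j + 1) → ‖BlockAveragingEMLLinearisedBackground.pertVar (Averaging.iter (fun i' => BlockAveraging.blockAvg (P := F.P K) (j := i') T3UnitLawDensityEML.ℰp) i U) (GaugeField.gaugeAct h (Averaging.iter (fun i' => BlockAveraging.blockAvg (P := F.P K) (j := i') T3UnitLawDensityEML.ℰp) i U')) b‖ ≤ Λ * ((Real.sqrt R)⁻¹ + Real.sqrt (T3UnitScaleTilt.θBal F.L γ b₀ p₀ (K - i)) * Real.sqrt R)) :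
    Summit.QuantumFields.YangMills.Theses.PoincareLipschitz.BlockLipschitzL := by
  have hA := stub_levelOneLipschitz
  have hB := stub_iteratedLipschitz_of_orbitMinHolderRegularity hRegH
  intro L
  obtain ⟨C1, hC1, HA⟩ := hA L
  obtain ⟨C2, hC2, HB⟩ := hB L
  refine ⟨max C1 C2, le_max_of_le_left hC1, ?_⟩
  intro b₀ p₀ hb hp
  obtain ⟨γa, hγa, hγa1, HA'⟩ := HA b₀ p₀ hb hp
  obtain ⟨γb, hγb, hγb1, HB'⟩ := HB b₀ p₀ hb hp
  refine ⟨min γa γb, lt_min hγa hγb, (min_le_left _ _).trans hγa1, ?_⟩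
  intro F γ hFL hγ hγ1 K j hj hjK a U U' hU hU'
  by_cases hcase : j ≤ 1
  · have h := HA' F γ hFL hγ (hγ1.trans (min_le_left γa γb)) K j hj hjK hcase a U U' hU hU'
    refine h.trans (mul_le_mul_of_nonneg_right ?_ (Real.sqrt_nonneg _))
    exact div_le_div_of_nonneg_right (le_max_left _ _) (Real.sqrt_nonneg _)
  · have h := HB' F γ hFL hγ (hγ1.trans (min_le_right γa γb)) K j hj hjK (by omega) a U U' hU hU'
    refine h.trans (mul_le_mul_of_nonneg_right ?_ (Real.sqrt_nonneg _))
    exact div_le_div_of_nonneg_right (le_max_right _ _) (Real.sqrt_nonneg _)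

end Summit.QuantumFields.YangMills.Theorems.PoincareLipschitzChartsOfOrbitMinHolderRegularity

end
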